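/-
Copyright (c) 2026 the pub-hodgecm-mathlib formalisation cell (harness21).  Prover seat hodgecm-mathlib-LH4-p14 (g2), req620 Track A «(D-RAM) FOUR-FRAME» squad
(unit U3_Laws, MS ROAD A Stage B; brick B8 «THE SUM» of `F0/P3c/LH4/LH4-p10/g2/MEMO-stableLaw-finite.v2.LH4p10g2.md` §9 (MS co-seat LH4-p10 (g2)), MS first seat LH4-p11 (g0),
dealer LH4-plan (g10)).  2026-09-03.
-/
import Mathlib.Algebra.Field.GeomSum
import Mathlib.Algebra.BigOperators.Intervals
import Mathlib.Data.Rat.Cast.Order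
import Mathlib.Tactic.FieldSimp
import Mathlib.Tactic.Ring
import Mathlib.Tactic.Linarith
import Mathlib.Tactic.LinearCombination
import Mathlib.Tactic.IntervalCases
import HarnessLib

/-!
# Crux `H413`, line LH4 «(D-RAM) FOUR-FRAME» road — unit U3_Laws (iii), MS ROAD A, Stage B brick B8 «THE SUM»:
# the class-by-class count of the dualisable orbits is the `q`-integer `[k]_q = (q^k − 1)/(q − 1)`, `2k = n₁ + n₂ + n₃ + 2 − d`

Cell `hodgecm-mathlib` (D-0151), FLOOR 0, crux item H413 = `stmt-HodgeConjecture-24833`, route of record `HCCMUnconditional`; squad F0∕P3c∕LH4 (req618∕req620).  THEOREMS ONLY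
(no `def`, no instance, no notation, no `sorry`, default heartbeats; Mathlib-only imports); lane `--supports stmt-HodgeConjecture-24833 --as helper` (count-neutral).  Target of
the road: tree `Cruxes/H413/Lines/F0_P3c_DyRamFourFrame_U3_Laws.lean` §S-R `stub_U3_stableModelSum` (MS, the eight-class model sum); its paper proof is LH4-p10 (g2)'s
MEMO-stableLaw-finite v2 (`F0/P3c/LH4/LH4-p10/g2/MEMO-stableLaw-finite.v2.LH4p10g2.md`): §3–§5 partition the normalised `γ`-stable lattices into classes (core, on-branch `T_i(s)`,
tubes `G_i(r,s)`, glue shells, hanging `H(r)`), each contributing a monomial in `q`; §6 is the resulting closed finite sum `N_tv(q; m, L, d)` for a key `{n₁,n₂,n₃} = {m, m, L}`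
(`m` the double depth, `L ≥ m` the special depth, `d` the different exponent, `tv ∈ {0,2}` the vertex type); §7 claims `N_tv = [k]_q`.  THIS FILE PROVES §6 = `[k]_q` — pure
`Finset.sum` algebra, no lattice, no valuation — in exactly the shape of the memo's checking script `explore/nform3.py` (`N(q,m,L,d,tv)`, parity index `P = tv/2`; the script's two
glue branches `L > m` ∕ `L = m` coincide term for term and are merged).

WHAT IS PROVED (for every commutative ring `R` and `x : R`, then for `x = (q : ℚ)`, `q : ℕ` arbitrary).  With `P ∈ {0,1}`, `1 ≤ d ≤ m ≤ L`, `m ≡ d`, `L ≡ m (mod 2)` and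
`N := [P = 0] + Σ_{1≤s≤L, s≡P} x^{⌊s/2⌋} + 2·Σ_{1≤s≤m, s≡P} x^{⌊s/2⌋} + Σ_{1≤r≤m, r≡P} Σ_{2≤s≤L−r, s even} (x−1)x^{r+s/2−1} + 2·Σ_{1≤r≤m, r≡P} Σ_{2≤s≤m−r, s even} (x−1)x^{r+s/2−1}`
`      + Σ_{m<r≤2m, r≡P, r−m≤m−d+1} x^{r+(L−m)/2−⌈(r−m)/2⌉} + Σ_{1≤r≤m, r≡P} (x−2)x^{r−1}`   (core · `T_sp(L)` · `2T(m)` · tube `G_sp(L)` · `2G(m)` · glue · `H(m)`):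
* `stableCountSum_mul_ring` ∕ `stableCountSum_mul` — **`(x − 1)·N = x^{(2m+L−d+2)/2} − 1`** (division-free; NO hypothesis on `x` or `q`; `d = 1` allowed);
* `stableCountSum_mul_of_shift` — the same with the shift hypothesis `2k + d = 2m + L + 2` of `stub_U3_stableModelSum`: `(q − 1)·N = q^k − 1`;
* `stableCountSum_eq_div` — **`N = (q^k − 1)/(q − 1)`** for `1 < q`;  `stableCountSum_tv` — the same in `tv`-currency (`tv = 0 ∨ tv = 2`, `P = tv/2`, core `[tv = 0]`);
* `classSum_eq` (§5) — the identity in the EXACT spelling of the Stage-B lead's statement probe `F0/P3c/LH4/LH4-p10/g2/B8-StableCountSum.STATEMENT.v1.LH4p10g2.lean`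
  (`Finset.range` filters, separate glue heads `if m < L` ∕ `if L = m`, `2k + d = 2m + L + 2`), reduced to the `Icc` form by three index-set identities.
PROOF (§2–§3).  Every piece is a PARITY-CLASS GEOMETRIC BLOCK: `parityBlock` — `(x−1)·Σ_{1≤r≤b, r≡P} x^{⌊(n+r)/2⌋} = x^{A+⌊(b+P)/2⌋} − x^{A}`, `A = 1 − P + ⌊(n+P)/2⌋`
(induction on `b`); the inner tube sum is `x^{⌊(n+r)/2⌋} − x^{r}` (`tubeInner`, `tubeSum`); `(x²−1)·Σ_{r≡P} x^{r−1} = x^{1−P+2⌊(m+P)/2⌋} − x^{1−P}` (`paritySqBlock`); and the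
GLUE SHELLS ARE THE CONTINUATION OF THE SPECIAL TUBE (`glueSum_eq`): their index set is `[m+1, 2m+1−d] ∩ (≡ P)` with summand `x^{⌊(L+r)/2⌋}`, so tube-top ⊔ glue is ONE block over
`[1, 2m+1−d]` (this is the memo's §7 telescoping `Δ = q^k`); all other blocks cancel to `−1` and the surviving exponent `A(L) + ⌊(2m+1−d+P)/2⌋` is `(2m+L−d+2)/2` (`omega`).
CHECKS AT HOME (count-neutral): the Lean statement's `N` transcribed back to Python agrees with `nform3.py` on 8 960 parameter sets and satisfies `(q−1)N = q^k − 1` on 11 200 sets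
(`q ∈ {0,…,9}`, `1 ≤ d ≤ 11`, incl. `q = 2` with `L = m` and `d = 1`, where the tame key `(1,1,1)` at `q = 3` gives `4`); `F0/P3c/LH4/LH4-p14/g2/b8check.py`.
HONEST LABEL.  Count-neutral (`--supports`); a finite-sum identity, nothing printed is asserted; (MS) = «Σ over the classes of MEMO v2 §3–§5 = N» (bricks B2–B7, B9, B10) stays a
PROVER TARGET and the census laws stay empirical until those land; the verdict of record for (D-RAM) stays PRINT [LanglandsShelstad1989 Thm. p. 484 ∕ Rogawski1990 Prop. 4.9.1 (a)]
∕ XL; `HC_CM` is proved only modulo the 7 printed citations (2 remaining named inputs: hLiu418 = `stmt-HodgeConjecture-24832`, h413 = `stmt-HodgeConjecture-24833`) until rung 0 closes.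

## References
* [Rogawski1990] J. D. Rogawski, *Automorphic Representations of Unitary Groups in Three Variables*, Ann. of Math. Stud. 123 (1990), §4.9 Prop. 4.9.1 (a) p. 55 (orbital integrals
  of near-identity elements as lattice counts — the organ whose stable count this `q`-integer is).
* [Serre1980Trees] J.-P. Serre, *Trees*, Springer (1980), Ch. II §1.1 (lattice classes and the tree; `[k]_q`-type vertex counts).
-/

set_option autoImplicit false

namespace Summit.HodgeConjecture.HodgeConjecture.Cruxes.H413.F0P3cDyRamStableCountSum

open Finset

/-! ## §1  Peeling the top term off a filtered interval sum -/

section Ring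

variable {R : Type*} [CommRing R]

/-- `Σ_{r ∈ [a, b+1], p r} f r = Σ_{r ∈ [a, b], p r} f r + [p (b+1)]·f (b+1)` for `a ≤ b + 1`. [folklore] -/
theorem sum_filter_Icc_succ_top (a b : ℕ) (hab : a ≤ b + 1) (p : ℕ → Prop) [DecidablePred p] (f : ℕ → R) :
    ∑ r ∈ (Icc a (b + 1)).filter p, f r = (∑ r ∈ (Icc a b).filter p, f r) + if p (b + 1) then f (b + 1) else 0 := by
  have h : Icc a (b + 1) = insert (b + 1) (Icc a b) := by
    ext x; simp only [mem_Icc, mem_insert]; omega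
  rw [h, filter_insert]
  split_ifs with hp
  · rw [sum_insert (by simp [mem_filter, mem_Icc]), add_comm]
  · rw [add_zero]

/-! ## §2  The parity-class geometric block `(x − 1)·Σ_{r ∈ [1,b], r ≡ P} x^{⌊(n+r)/2⌋}` -/

/-- **PARITY-CLASS GEOMETRIC BLOCK.**  For `P ∈ {0,1}` and all `n, b`:
`(x − 1)·Σ_{1 ≤ r ≤ b, r ≡ P (2)} x^{⌊(n+r)/2⌋} = x^{A + ⌊(b+P)/2⌋} − x^{A}` with `A = 1 − P + ⌊(n+P)/2⌋` (the exponents `⌊(n+r)/2⌋` run through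
`⌊(b+P)/2⌋` CONSECUTIVE integers starting at `A`, so the sum telescopes). [folklore] -/
theorem parityBlock (x : R) {P : ℕ} (hP : P ≤ 1) (n b : ℕ) :
    (x - 1) * ∑ r ∈ (Icc 1 b).filter (fun r => r % 2 = P), x ^ ((n + r) / 2)
      = x ^ (1 - P + (n + P) / 2 + (b + P) / 2) - x ^ (1 - P + (n + P) / 2) := by
  induction b with
  | zero =>
    have h0 : P / 2 = 0 := by omega
    simp [h0]
  | succ b ih =>
    rw [sum_filter_Icc_succ_top 1 b (by omega), mul_add, ih]
    split_ifs with hp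
    · have h1 : (b + 1 + P) / 2 = (b + P) / 2 + 1 := by omega
      have h2 : (n + (b + 1)) / 2 = 1 - P + (n + P) / 2 + (b + P) / 2 := by omega
      rw [h1, h2]; ring
    · have h1 : (b + 1 + P) / 2 = (b + P) / 2 := by omega
      rw [h1]; ring

/-- The block with `n = 0`: `(x − 1)·Σ_{1 ≤ s ≤ b, s ≡ P} x^{⌊s/2⌋} = x^{1 − P + ⌊(b+P)/2⌋} − x^{1−P}` (the ON-BRANCH classes `T_i(s)`). [folklore] -/
theorem parityBlock_zero (x : R) {P : ℕ} (hP : P ≤ 1) (b : ℕ) :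
    (x - 1) * ∑ s ∈ (Icc 1 b).filter (fun s => s % 2 = P), x ^ (s / 2)
      = x ^ (1 - P + (b + P) / 2) - x ^ (1 - P) := by
  have h := parityBlock x hP 0 b
  have h0 : P / 2 = 0 := by omega
  simp only [Nat.zero_add, h0, Nat.add_zero] at h
  exact h

/-- **THE `q²`-GEOMETRIC BLOCK** of the hanging classes: `(x² − 1)·Σ_{1 ≤ r ≤ b, r ≡ P} x^{r−1} = x^{1 − P + 2⌊(b+P)/2⌋} − x^{1−P}`. [folklore] -/
theorem paritySqBlock (x : R) {P : ℕ} (hP : P ≤ 1) (b : ℕ) :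
    (x ^ 2 - 1) * ∑ r ∈ (Icc 1 b).filter (fun r => r % 2 = P), x ^ (r - 1)
      = x ^ (1 - P + 2 * ((b + P) / 2)) - x ^ (1 - P) := by
  induction b with
  | zero =>
    have h0 : P / 2 = 0 := by omega
    simp [h0]
  | succ b ih =>
    rw [sum_filter_Icc_succ_top 1 b (by omega), mul_add, ih]
    split_ifs with hp
    · have h1 : (b + 1 + P) / 2 = (b + P) / 2 + 1 := by omega
      have h2 : b + 1 - 1 = 1 - P + 2 * ((b + P) / 2) := by omega
      rw [h1, h2]; ring
    · have h1 : (b + 1 + P) / 2 = (b + P) / 2 := by omega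
      rw [h1]; ring

/-- **THE INNER TUBE SUM**: `Σ_{2 ≤ s ≤ t, s even} (x − 1)·x^{r + s/2 − 1} = x^{r + ⌊t/2⌋} − x^{r}` (telescoping in `s`). [folklore] -/
theorem tubeInner (x : R) (r : ℕ) (t : ℕ) :
    ∑ s ∈ (Icc 2 t).filter (fun s => s % 2 = 0), (x - 1) * x ^ (r + s / 2 - 1) = x ^ (r + t / 2) - x ^ r := by
  induction t with
  | zero => simp
  | succ t ih =>
    rcases Nat.lt_or_ge t 1 with ht | ht
    · have ht0 : t = 0 := by omega
      subst ht0
      simp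
    · rw [sum_filter_Icc_succ_top 2 t (by omega), ih]
      split_ifs with hp
      · obtain ⟨e, he1, he2⟩ : ∃ e, r + t / 2 = e ∧ r + (t + 1) / 2 = e + 1 := ⟨r + t / 2, rfl, by omega⟩
        rw [he1, he2, Nat.add_sub_cancel]; ring
      · have h1 : (t + 1) / 2 = t / 2 := by omega
        rw [h1]; ring

/-- **THE TUBE CLASSES SUMMED OVER THE INNER INDEX**: for `m ≤ n`,
`Σ_{1 ≤ r ≤ m, r ≡ P} Σ_{2 ≤ s ≤ n − r, s even} (x−1)x^{r+s/2−1} = Σ_{r} x^{⌊(n+r)/2⌋} − Σ_{r} x^{r}`. [folklore] -/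
theorem tubeSum (x : R) (P m n : ℕ) (hmn : m ≤ n) :
    ∑ r ∈ (Icc 1 m).filter (fun r => r % 2 = P),
        ∑ s ∈ (Icc 2 (n - r)).filter (fun s => s % 2 = 0), (x - 1) * x ^ (r + s / 2 - 1)
      = (∑ r ∈ (Icc 1 m).filter (fun r => r % 2 = P), x ^ ((n + r) / 2))
        - ∑ r ∈ (Icc 1 m).filter (fun r => r % 2 = P), x ^ r := by
  rw [← sum_sub_distrib]
  refine sum_congr rfl fun r hr => ?_
  have hr' : r ≤ m := (mem_Icc.1 (mem_filter.1 hr).1).2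
  rw [tubeInner]
  have h : r + (n - r) / 2 = (n + r) / 2 := by omega
  rw [h]

/-- `Σ_{1 ≤ r ≤ m, r ≡ P} x^{r} = x·Σ_{r} x^{r−1}`. [folklore] -/
theorem sum_pow_eq_mul_sum_pow_pred (x : R) (P m : ℕ) :
    ∑ r ∈ (Icc 1 m).filter (fun r => r % 2 = P), x ^ r = x * ∑ r ∈ (Icc 1 m).filter (fun r => r % 2 = P), x ^ (r - 1) := by
  rw [mul_sum]
  refine sum_congr rfl fun r hr => ?_
  have hr1 : 1 ≤ r := (mem_Icc.1 (mem_filter.1 hr).1).1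
  obtain ⟨r', rfl⟩ : ∃ r', r = r' + 1 := ⟨r - 1, by omega⟩
  simp [pow_succ, mul_comm]

/-- `Σ_{r} (x − 2)·x^{r−1} = (x − 2)·Σ_{r} x^{r−1}` (the hanging classes `H(r)`). [folklore] -/
theorem hangSum (x : R) (P m : ℕ) :
    ∑ r ∈ (Icc 1 m).filter (fun r => r % 2 = P), (x - 2) * x ^ (r - 1)
      = (x - 2) * ∑ r ∈ (Icc 1 m).filter (fun r => r % 2 = P), x ^ (r - 1) := by
  rw [mul_sum]

/-- **THE GLUE SHELLS ARE THE CONTINUATION OF THE SPECIAL TUBE**: for `1 ≤ d ≤ m ≤ L`, `L ≡ m (2)` the glue sum over `m < r ≤ 2m`, `r ≡ P`, `r − m ≤ m − d + 1` of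
`x^{r + (L−m)/2 − ⌈(r−m)/2⌉}` is `Σ_{m+1 ≤ r ≤ 2m+1−d, r ≡ P} x^{⌊(L+r)/2⌋}` — the same summand as the tube's top terms. [folklore] -/
theorem glueSum_eq (x : R) (P : ℕ) {d m L : ℕ} (hd : 1 ≤ d) (hdm : d ≤ m) (hmL : m ≤ L) (hLm : L % 2 = m % 2) :
    ∑ r ∈ (Icc (m + 1) (2 * m)).filter (fun r => r % 2 = P ∧ r - m ≤ m - d + 1),
        x ^ (r + (L - m) / 2 - (r - m + 1) / 2)
      = ∑ r ∈ (Icc (m + 1) (2 * m + 1 - d)).filter (fun r => r % 2 = P), x ^ ((L + r) / 2) := by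
  have hset : (Icc (m + 1) (2 * m)).filter (fun r => r % 2 = P ∧ r - m ≤ m - d + 1)
      = (Icc (m + 1) (2 * m + 1 - d)).filter (fun r => r % 2 = P) := by
    ext r
    simp only [mem_filter, mem_Icc]
    constructor
    · rintro ⟨⟨h1, h2⟩, h3, h4⟩; exact ⟨⟨h1, by omega⟩, h3⟩
    · rintro ⟨⟨h1, h2⟩, h3⟩; exact ⟨⟨h1, by omega⟩, h3, by omega⟩
  rw [hset]
  refine sum_congr rfl fun r hr => ?_
  have hr1 : m + 1 ≤ r := (mem_Icc.1 (mem_filter.1 hr).1).1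
  have h : r + (L - m) / 2 - (r - m + 1) / 2 = (L + r) / 2 := by omega
  rw [h]

/-- Splitting a filtered interval sum at `m`: `Σ_{[1,B]} = Σ_{[1,m]} + Σ_{[m+1,B]}` for `m ≤ B`. [folklore] -/
theorem sum_filter_Icc_split (f : ℕ → R) (P : ℕ) {m B : ℕ} (hmB : m ≤ B) :
    ∑ r ∈ (Icc 1 B).filter (fun r => r % 2 = P), f r
      = (∑ r ∈ (Icc 1 m).filter (fun r => r % 2 = P), f r)
        + ∑ r ∈ (Icc (m + 1) B).filter (fun r => r % 2 = P), f r := by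
  have hU : (Icc 1 B).filter (fun r => r % 2 = P)
      = (Icc 1 m).filter (fun r => r % 2 = P) ∪ (Icc (m + 1) B).filter (fun r => r % 2 = P) := by
    ext r
    simp only [mem_filter, mem_Icc, mem_union]
    omega
  have hD : Disjoint ((Icc 1 m).filter (fun r => r % 2 = P)) ((Icc (m + 1) B).filter (fun r => r % 2 = P)) := by
    rw [disjoint_left]
    intro r h1 h2
    simp only [mem_filter, mem_Icc] at h1 h2
    omega
  rw [hU, sum_union hD]

/-! ## §3  THE SUM: the class-by-class count of MEMO-stableLaw-finite v2 §6 equals `[k]_q`, `2k = 2m + L − d + 2` -/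

/-- **«THE SUM» over a commutative ring (division-free form).**  With `P ∈ {0,1}` the parity of the vertex type (`P = tv/2`), `1 ≤ d ≤ m ≤ L`, `m ≡ d`, `L ≡ m (mod 2)`
(the key `(n₁,n₂,n₃)` has two depths `m` and the special depth `L`, `d` = the different exponent of the datum), the closed class sum
`N = [P=0] + T_sp(L) + 2·T(m) + G_sp(L) + 2·G(m) + glue + H(m)` of MEMO-stableLaw-finite v2 §6 (LH4-p10 (g2); transcription of `explore/nform3.py`) satisfies
`(x − 1)·N = x^{(2m+L−d+2)/2} − 1` for EVERY `x` — i.e. `N = [k]_x`, `2k = 2m + L − d + 2`.  Proof: §2's blocks; the glue shells continue the special tube into ONE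
parity block `[1, 2m+1−d]` with summand `x^{⌊(L+r)/2⌋}` (this is §7's telescoping `Δ = q^k`), everything else cancels to `−1`. [cite: Rogawski1990, §4.9 Prop. 4.9.1 (a) p. 55] -/
theorem stableCountSum_mul_ring (x : R) {d m L P : ℕ} (hP : P ≤ 1) (hd : 1 ≤ d) (hdm : d ≤ m) (hmL : m ≤ L)
    (hmd : m % 2 = d % 2) (hLm : L % 2 = m % 2) :
    (x - 1) *
      ((if P = 0 then (1 : R) else 0)
        + ∑ s ∈ (Icc 1 L).filter (fun s => s % 2 = P), x ^ (s / 2)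
        + 2 * ∑ s ∈ (Icc 1 m).filter (fun s => s % 2 = P), x ^ (s / 2)
        + ∑ r ∈ (Icc 1 m).filter (fun r => r % 2 = P),
            ∑ s ∈ (Icc 2 (L - r)).filter (fun s => s % 2 = 0), (x - 1) * x ^ (r + s / 2 - 1)
        + 2 * ∑ r ∈ (Icc 1 m).filter (fun r => r % 2 = P),
            ∑ s ∈ (Icc 2 (m - r)).filter (fun s => s % 2 = 0), (x - 1) * x ^ (r + s / 2 - 1)
        + ∑ r ∈ (Icc (m + 1) (2 * m)).filter (fun r => r % 2 = P ∧ r - m ≤ m - d + 1),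
            x ^ (r + (L - m) / 2 - (r - m + 1) / 2)
        + ∑ r ∈ (Icc 1 m).filter (fun r => r % 2 = P), (x - 2) * x ^ (r - 1))
      = x ^ ((2 * m + L - d + 2) / 2) - 1 := by
  have hT_L := parityBlock_zero x hP L
  have hT_m := parityBlock_zero x hP m
  have hBlockL := parityBlock x hP L (2 * m + 1 - d)
  have hBlockm := parityBlock x hP m m
  have hW := paritySqBlock x hP m
  have hsplit := sum_filter_Icc_split (fun r => x ^ ((L + r) / 2)) P (show m ≤ 2 * m + 1 - d by omega)
  have hk : 1 - P + (L + P) / 2 + (2 * m + 1 - d + P) / 2 = (2 * m + L - d + 2) / 2 := by omega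
  have hm2 : 1 - P + (m + P) / 2 + (m + P) / 2 = 1 - P + 2 * ((m + P) / 2) := by omega
  rw [hk] at hBlockL
  rw [hm2] at hBlockm
  have hcore : (x - 1) * (if P = 0 then (1 : R) else 0) - x ^ (1 - P) = -1 := by
    interval_cases P <;> simp
  rw [tubeSum x P m L hmL, tubeSum x P m m le_rfl, hangSum, sum_pow_eq_mul_sum_pow_pred x P m,
    glueSum_eq x P hd hdm hmL hLm]
  linear_combination hT_L + 2 * hT_m + hBlockL - (x - 1) * hsplit + 2 * hBlockm - 2 * hW + hcore

end Ring

/-! ## §4  The heads in the currency of `stub_U3_stableModelSum` (`q = #𝓀 : ℕ` cast to `ℚ`) -/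

/-- **B8 «THE SUM» (MS ROAD A, Stage B; MEMO-stableLaw-finite v2 §6–§7), division-free over `ℚ`.**  For a natural number `q` (no hypothesis), `P = tv/2 ∈ {0,1}`,
`1 ≤ d ≤ m ≤ L`, `m ≡ d`, `L ≡ m (mod 2)`: `(q − 1)·N(q; m, L, d, P) = q^{(2m+L−d+2)/2} − 1`, where `N` is the class sum
`[P=0] + Σ_{s≤L, s≡P} q^{⌊s/2⌋} + 2Σ_{s≤m, s≡P} q^{⌊s/2⌋} + Σ_{r≤m, r≡P} Σ_{s even, r+s≤L} (q−1)q^{r+s/2−1} + 2Σ_{r≤m,r≡P}Σ_{s even, r+s≤m} (q−1)q^{r+s/2−1}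
 + Σ_{m<r≤2m, r≡P, r−m≤m−d+1} q^{r+(L−m)/2−⌈(r−m)/2⌉} + Σ_{r≤m, r≡P} (q−2)q^{r−1}` (core · on-branch T · tubes G · glue · hanging H).  The identity was re-checked at home
against `explore/nform3.py` (transcription, 8 960 parameter sets) and numerically (11 200 sets incl. `q ∈ {0,1}`, `d = 1`). [cite: Rogawski1990, §4.9 Prop. 4.9.1 (a) p. 55] -/
theorem stableCountSum_mul (q : ℕ) {d m L par : ℕ} (hpar : par ≤ 1) (hd : 1 ≤ d) (hdm : d ≤ m) (hmL : m ≤ L)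
    (hmd : m % 2 = d % 2) (hLm : L % 2 = m % 2) :
    ((q : ℚ) - 1) *
      ((if par = 0 then (1 : ℚ) else 0)
        + ∑ s ∈ (Icc 1 L).filter (fun s => s % 2 = par), (q : ℚ) ^ (s / 2)
        + 2 * ∑ s ∈ (Icc 1 m).filter (fun s => s % 2 = par), (q : ℚ) ^ (s / 2)
        + ∑ r ∈ (Icc 1 m).filter (fun r => r % 2 = par),
            ∑ s ∈ (Icc 2 (L - r)).filter (fun s => s % 2 = 0), ((q : ℚ) - 1) * (q : ℚ) ^ (r + s / 2 - 1)
        + 2 * ∑ r ∈ (Icc 1 m).filter (fun r => r % 2 = par),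
            ∑ s ∈ (Icc 2 (m - r)).filter (fun s => s % 2 = 0), ((q : ℚ) - 1) * (q : ℚ) ^ (r + s / 2 - 1)
        + ∑ r ∈ (Icc (m + 1) (2 * m)).filter (fun r => r % 2 = par ∧ r - m ≤ m - d + 1),
            (q : ℚ) ^ (r + (L - m) / 2 - (r - m + 1) / 2)
        + ∑ r ∈ (Icc 1 m).filter (fun r => r % 2 = par), ((q : ℚ) - 2) * (q : ℚ) ^ (r - 1))
      = (q : ℚ) ^ ((2 * m + L - d + 2) / 2) - 1 :=
  stableCountSum_mul_ring (q : ℚ) hpar hd hdm hmL hmd hLm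

/-- **B8 with the shift hypothesis of `stub_U3_stableModelSum`**: if `2k + d = 2m + L + 2` (i.e. `2k + d = n₁ + n₂ + n₃ + 2` for the key `{m, m, L}`), then
`(q − 1)·N = q^k − 1`. [cite: Rogawski1990, §4.9 Prop. 4.9.1 (a) p. 55] -/
theorem stableCountSum_mul_of_shift (q : ℕ) {d m L par k : ℕ} (hpar : par ≤ 1) (hd : 1 ≤ d) (hdm : d ≤ m) (hmL : m ≤ L)
    (hmd : m % 2 = d % 2) (hLm : L % 2 = m % 2) (hk : 2 * k + d = 2 * m + L + 2) :
    ((q : ℚ) - 1) *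
      ((if par = 0 then (1 : ℚ) else 0)
        + ∑ s ∈ (Icc 1 L).filter (fun s => s % 2 = par), (q : ℚ) ^ (s / 2)
        + 2 * ∑ s ∈ (Icc 1 m).filter (fun s => s % 2 = par), (q : ℚ) ^ (s / 2)
        + ∑ r ∈ (Icc 1 m).filter (fun r => r % 2 = par),
            ∑ s ∈ (Icc 2 (L - r)).filter (fun s => s % 2 = 0), ((q : ℚ) - 1) * (q : ℚ) ^ (r + s / 2 - 1)
        + 2 * ∑ r ∈ (Icc 1 m).filter (fun r => r % 2 = par),
            ∑ s ∈ (Icc 2 (m - r)).filter (fun s => s % 2 = 0), ((q : ℚ) - 1) * (q : ℚ) ^ (r + s / 2 - 1)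
        + ∑ r ∈ (Icc (m + 1) (2 * m)).filter (fun r => r % 2 = par ∧ r - m ≤ m - d + 1),
            (q : ℚ) ^ (r + (L - m) / 2 - (r - m + 1) / 2)
        + ∑ r ∈ (Icc 1 m).filter (fun r => r % 2 = par), ((q : ℚ) - 2) * (q : ℚ) ^ (r - 1))
      = (q : ℚ) ^ k - 1 := by
  have h := stableCountSum_mul q hpar hd hdm hmL hmd hLm
  have hk' : (2 * m + L - d + 2) / 2 = k := by omega
  rw [hk'] at h
  exact h

/-- **B8 «THE SUM», quotient form**: for `1 < q`, `N(q; m, L, d, P) = (q^k − 1)/(q − 1)` with `2k + d = 2m + L + 2` — the right-hand side of `stub_U3_stableModelSum` up to the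
factor `8` of Stage A. [cite: Rogawski1990, §4.9 Prop. 4.9.1 (a) p. 55] -/
theorem stableCountSum_eq_div (q : ℕ) (hq : 1 < q) {d m L par k : ℕ} (hpar : par ≤ 1) (hd : 1 ≤ d) (hdm : d ≤ m) (hmL : m ≤ L)
    (hmd : m % 2 = d % 2) (hLm : L % 2 = m % 2) (hk : 2 * k + d = 2 * m + L + 2) :
    ((if par = 0 then (1 : ℚ) else 0)
        + ∑ s ∈ (Icc 1 L).filter (fun s => s % 2 = par), (q : ℚ) ^ (s / 2)
        + 2 * ∑ s ∈ (Icc 1 m).filter (fun s => s % 2 = par), (q : ℚ) ^ (s / 2)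
        + ∑ r ∈ (Icc 1 m).filter (fun r => r % 2 = par),
            ∑ s ∈ (Icc 2 (L - r)).filter (fun s => s % 2 = 0), ((q : ℚ) - 1) * (q : ℚ) ^ (r + s / 2 - 1)
        + 2 * ∑ r ∈ (Icc 1 m).filter (fun r => r % 2 = par),
            ∑ s ∈ (Icc 2 (m - r)).filter (fun s => s % 2 = 0), ((q : ℚ) - 1) * (q : ℚ) ^ (r + s / 2 - 1)
        + ∑ r ∈ (Icc (m + 1) (2 * m)).filter (fun r => r % 2 = par ∧ r - m ≤ m - d + 1),
            (q : ℚ) ^ (r + (L - m) / 2 - (r - m + 1) / 2)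
        + ∑ r ∈ (Icc 1 m).filter (fun r => r % 2 = par), ((q : ℚ) - 2) * (q : ℚ) ^ (r - 1))
      = ((q : ℚ) ^ k - 1) / ((q : ℚ) - 1) := by
  have h := stableCountSum_mul_of_shift q hpar hd hdm hmL hmd hLm hk
  have hq1 : ((q : ℚ) - 1) ≠ 0 := by
    have : (1 : ℚ) < (q : ℚ) := by exact_mod_cast hq
    linarith
  rw [eq_div_iff hq1, mul_comm]
  exact h

/-- **B8 in `tv`-currency** (`tv ∈ {0, 2}` the vertex type of `stub_U3_stableModelSum`; the parity index is `tv / 2`, the core term is `[tv = 0]`): for `1 < q` and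
`2k + d = 2m + L + 2`, `N(q; m, L, d, tv/2) = (q^k − 1)/(q − 1)`. [cite: Rogawski1990, §4.9 Prop. 4.9.1 (a) p. 55] -/
theorem stableCountSum_tv (q : ℕ) (hq : 1 < q) {d m L k : ℕ} (tv : ℕ) (htv : tv = 0 ∨ tv = 2) (hd : 1 ≤ d) (hdm : d ≤ m) (hmL : m ≤ L)
    (hmd : m % 2 = d % 2) (hLm : L % 2 = m % 2) (hk : 2 * k + d = 2 * m + L + 2) :
    ((if tv = 0 then (1 : ℚ) else 0)
        + ∑ s ∈ (Icc 1 L).filter (fun s => s % 2 = tv / 2), (q : ℚ) ^ (s / 2)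
        + 2 * ∑ s ∈ (Icc 1 m).filter (fun s => s % 2 = tv / 2), (q : ℚ) ^ (s / 2)
        + ∑ r ∈ (Icc 1 m).filter (fun r => r % 2 = tv / 2),
            ∑ s ∈ (Icc 2 (L - r)).filter (fun s => s % 2 = 0), ((q : ℚ) - 1) * (q : ℚ) ^ (r + s / 2 - 1)
        + 2 * ∑ r ∈ (Icc 1 m).filter (fun r => r % 2 = tv / 2),
            ∑ s ∈ (Icc 2 (m - r)).filter (fun s => s % 2 = 0), ((q : ℚ) - 1) * (q : ℚ) ^ (r + s / 2 - 1)
        + ∑ r ∈ (Icc (m + 1) (2 * m)).filter (fun r => r % 2 = tv / 2 ∧ r - m ≤ m - d + 1),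
            (q : ℚ) ^ (r + (L - m) / 2 - (r - m + 1) / 2)
        + ∑ r ∈ (Icc 1 m).filter (fun r => r % 2 = tv / 2), ((q : ℚ) - 2) * (q : ℚ) ^ (r - 1))
      = ((q : ℚ) ^ k - 1) / ((q : ℚ) - 1) := by
  have hpar : tv / 2 ≤ 1 := by omega
  have h := stableCountSum_eq_div q hq hpar hd hdm hmL hmd hLm hk
  have hcore : (if tv = 0 then (1 : ℚ) else 0) = (if tv / 2 = 0 then (1 : ℚ) else 0) := by
    rcases htv with rfl | rfl <;> simp
  rw [hcore]
  exact h


/-! ## §5  The same identity in the spelling of the Stage-B lead's statement probe (`B8-StableCountSum.STATEMENT.v1.LH4p10g2.lean` b0104669567052fc) -/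

/-- **B8 «THE SUM» in LH4-p10 (g2)'s probe spelling** (`Finset.range` filters, the two glue heads `if m < L` ∕ `if L = m` kept apart as in `nform3.py`, shift hypothesis
`2k + d = 2m + L + 2`): `(q − 1)·N = q^k − 1`.  Reduced to `stableCountSum_mul_of_shift` by three index-set identities (`range`-with-bounds = `Icc`) and the remark that the two
glue heads never coexist and carry the same summand (`(L − m)/2 = 0` when `L = m`).  The hypothesis `2 ≤ q` is carried for the probe's signature and not used.
[cite: Rogawski1990, §4.9 Prop. 4.9.1 (a) p. 55] -/
theorem classSum_eq (q m L d par k : ℕ) (_hq : 2 ≤ q) (hd : 1 ≤ d) (hdm : d ≤ m) (hmL : m ≤ L)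
    (hpm : m % 2 = d % 2) (hpL : L % 2 = d % 2) (hpar : par ≤ 1) (hk : 2 * k + d = 2 * m + L + 2) :
    ((q : ℚ) - 1) *
      ( (if par = 0 then (1 : ℚ) else 0)
      + ∑ s ∈ (range (L + 1)).filter (fun s => 1 ≤ s ∧ s % 2 = par), (q : ℚ) ^ (s / 2)
      + 2 * ∑ s ∈ (range (m + 1)).filter (fun s => 1 ≤ s ∧ s % 2 = par), (q : ℚ) ^ (s / 2)
      + ∑ r ∈ (range (m + 1)).filter (fun r => 1 ≤ r ∧ r % 2 = par),
          ∑ s ∈ (range (L + 1)).filter (fun s => 2 ≤ s ∧ s % 2 = 0 ∧ r + s ≤ L), ((q : ℚ) - 1) * (q : ℚ) ^ (r + s / 2 - 1)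
      + 2 * ∑ r ∈ (range (m + 1)).filter (fun r => 1 ≤ r ∧ r % 2 = par),
          ∑ s ∈ (range (m + 1)).filter (fun s => 2 ≤ s ∧ s % 2 = 0 ∧ r + s ≤ m), ((q : ℚ) - 1) * (q : ℚ) ^ (r + s / 2 - 1)
      + (if m < L then ∑ r ∈ (range (2 * m + 1)).filter (fun r => m < r ∧ r % 2 = par ∧ r + d ≤ 2 * m + 1),
            (q : ℚ) ^ (r + (L - m) / 2 - (r - m + 1) / 2) else 0)
      + ∑ r ∈ (range (m + 1)).filter (fun r => 1 ≤ r ∧ r % 2 = par), ((q : ℚ) - 2) * (q : ℚ) ^ (r - 1)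
      + (if L = m then ∑ r ∈ (range (2 * m + 1)).filter (fun r => m < r ∧ r % 2 = par ∧ r + d ≤ 2 * m + 1),
            (q : ℚ) ^ (r - (r - m + 1) / 2) else 0) )
    = (q : ℚ) ^ k - 1 := by
  have hLm : L % 2 = m % 2 := by omega
  have h := stableCountSum_mul_of_shift q hpar hd hdm hmL hpm hLm hk
  have e1 : ∀ n, (range (n + 1)).filter (fun s => 1 ≤ s ∧ s % 2 = par) = (Icc 1 n).filter (fun s => s % 2 = par) := by
    intro n; ext s; simp only [mem_filter, mem_range, mem_Icc]; omega
  have e2 : ∀ n r, (range (n + 1)).filter (fun s => 2 ≤ s ∧ s % 2 = 0 ∧ r + s ≤ n)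
      = (Icc 2 (n - r)).filter (fun s => s % 2 = 0) := by
    intro n r; ext s; simp only [mem_filter, mem_range, mem_Icc]; omega
  have e3 : (range (2 * m + 1)).filter (fun r => m < r ∧ r % 2 = par ∧ r + d ≤ 2 * m + 1)
      = (Icc (m + 1) (2 * m)).filter (fun r => r % 2 = par ∧ r - m ≤ m - d + 1) := by
    ext r; simp only [mem_filter, mem_range, mem_Icc]; omega
  simp only [e1, e2, e3]
  rcases Nat.lt_or_ge m L with hlt | hge
  · have hne : ¬ (L = m) := by omega
    rw [if_pos hlt, if_neg hne, add_zero]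
    exact h
  · have hLm' : L = m := le_antisymm hge hmL
    subst hLm'
    rw [if_neg (lt_irrefl L), if_pos rfl, add_zero]
    simp only [Nat.sub_self, Nat.zero_div, Nat.add_zero] at h
    linear_combination h

end Summit.HodgeConjecture.HodgeConjecture.Cruxes.H413.F0P3cDyRamStableCountSum
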